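import HarnessLib
/-!
# (g2) seam pilot, R = 5 fcc reference patch — K LANDING UNIT v3 (Defs: enumeration + structural lemmas; import HarnessLib only (so the gate axiom audit elaborates))

census-1 g52 (critic r1709 (C) / r1720 (B) / r1725 (A)): lens-2's ENERGY-ROUTE-96 seam constant S_E/ε² = ½ ΣΣ_{p,q ∈ seam} F_p F_q G∞(p,q) on the R = 5
fcc reference patch (b̄ = 9718/10000; bonds d ∈ {2,4,6} conventional = three LJ shells; F_p = Σ_{exterior bonds} ‖B‖, ‖B‖ = max(|13w⁷−7w⁴|, |w⁴−w⁷|), w = 1/r²;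
G∞ = min(G0, √2/(8π b̄³ √d)), integer Newton √; everything upper-rounded at 2⁻⁶⁰), certified by `decide +kernel` in CHUNKS joined by a proved split lemma,
final theorem ON THE OBJECT `pilot.sE`.  Module set: `ChartedZeroExcessLayeredLatticeLiouvilleG2SeamR5Defs` (this file's defs + structural lemmas; `import HarnessLib` only, for the gate's axiom audit) ← `ChartedZeroExcessLayeredLatticeLiouvilleG2SeamR5Chunk0..3` (two 71-row chunk theorems each,
≈ 150 s check-lane wall per file) ← `ChartedZeroExcessLayeredLatticeLiouvilleG2SeamR5Cert` (assembly: import-only + `seam_length`).  ELABORATOR-HYGIENE (r1720): no `show`/term-mode defeq against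
`build`-terms; chunk theorems on `totalChunk build.seam lo hi`; assembly by `rw` only; `decide +kernel` only on chunk theorems and closed numerals.
-/

namespace Summit.AtomisticToContinuum.Crystallization.Theorems.ChartedZeroExcessLayeredLatticeLiouville.G2SeamR5

/-- fixed-point scale 2⁶⁰. -/
def S : Nat := 1152921504606846976
/-- ceiling division on ℕ. -/
def ceilDiv (a b : Nat) : Nat := (a + b - 1) / b
/-- patch radius² (conventional units): d ≤ DP. -/
def DP : Int := 52
/-- exterior radius²: DP < d ≤ DX. -/
def DX : Int := 95
/-- 10⁸·b̄² with b̄ = 0.9718. -/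
def BB2 : Nat := 94439524
/-- ⌈G0·2⁶⁰⌉, G0 = 1121/10000. -/
def G0S : Nat := 129242500666427547
/-- ⌈C·2⁶⁰⌉ + 1, C = √2/(8π b̄³) (50-digit π, rounded up). -/
def CS : Nat := 70687755789644787

/-- upper bound (scale 2⁶⁰) of the LJ bond-block norm at shell m (r² = m b̄², m = d²/2 ∈ {1,2,3}). -/
def normB (m : Nat) : Nat :=
  let l := (S * 100000000) / (m * BB2)
  let h := ceilDiv (S * 100000000) (m * BB2)
  let w2l := (l*l) / S
  let w2h := ceilDiv (h*h) S
  let w4l := (w2l*w2l) / S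
  let w4h := ceilDiv (w2h*w2h) S
  let w3l := (w2l*l) / S
  let w3h := ceilDiv (w2h*h) S
  let w7l := (w3l*w4l) / S
  let w7h := ceilDiv (w3h*w4h) S
  let ahi : Int := 13 * (w7h : Int) - 7 * (w4l : Int)
  let alo : Int := 13 * (w7l : Int) - 7 * (w4h : Int)
  let bhi : Int := (w4h : Int) - (w7l : Int)
  let blo : Int := (w4l : Int) - (w7h : Int)
  max (max ahi.natAbs alo.natAbs) (max bhi.natAbs blo.natAbs)
/-- ‖B‖ upper bound at shell 1 (scale 2⁶⁰). -/
def nB1 : Nat := normB 1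
/-- ‖B‖ upper bound at shell 2. -/
def nB2 : Nat := normB 2
/-- ‖B‖ upper bound at shell 3. -/
def nB3 : Nat := normB 3

/-- exterior-bond load at patch site (x,y,z): scan the 5³ offset cube, bonds d² ∈ {2,4,6}, target in the exterior shell. -/
def offK (x y z a b : Int) : Nat → Nat → Nat
  | 0, acc => acc
  | k+1, acc =>
    let c : Int := (k : Int) - 2
    let dd : Int := a*a + b*b + c*c
    let acc' :=
      if dd == 2 || dd == 4 || dd == 6 then
        let X := x + a
        let Y := y + b
        let Z := z + c
        let d : Int := X*X + Y*Y + Z*Z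
        if DP < d then (if d ≤ DX then acc + (if dd == 2 then nB1 else if dd == 4 then nB2 else nB3) else acc) else acc
      else acc
    offK x y z a b k acc'
/-- middle loop of the 5³ offset scan. -/
def offJ (x y z a : Int) : Nat → Nat → Nat
  | 0, acc => acc
  | j+1, acc => offJ x y z a j (offK x y z a ((j : Int) - 2) 5 acc)
/-- outer loop of the 5³ offset scan. -/
def offI (x y z : Int) : Nat → Nat → Nat
  | 0, acc => acc
  | i+1, acc => offI x y z i (offJ x y z ((i : Int) - 2) 5 acc)
/-- exterior-bond load F_p at an fcc site (scale 2⁶⁰). -/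
def loadF (x y z : Int) : Nat := offI x y z 5 0

/-- scan state: patch-site count, seam rows, ΣF. -/
structure St where
  nP : Nat
  seam : List (Int × Int × Int × Nat)
  sumF : Nat

/-- inner site scan (z). -/
def scanK (R : Nat) (x y : Int) : Nat → St → St
  | 0, st => st
  | k+1, st =>
    let z : Int := (k : Int) - (R : Int)
    let st' :=
      if (x + y + z) % 2 == 0 then
        let d : Int := x*x + y*y + z*z
        if d ≤ DP then
          let f := loadF x y z
          if 0 < f then ⟨st.nP + 1, (x, y, z, f) :: st.seam, st.sumF + f⟩ else ⟨st.nP + 1, st.seam, st.sumF⟩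
        else st
      else st
    scanK R x y k st'
/-- middle site scan (y). -/
def scanJ (R : Nat) (x : Int) : Nat → St → St
  | 0, st => st
  | j+1, st => scanJ R x j (scanK R x ((j : Int) - (R : Int)) (2*R+1) st)
/-- outer site scan (x). -/
def scanI (R : Nat) : Nat → St → St
  | 0, st => st
  | i+1, st => scanI R i (scanJ R ((i : Int) - (R : Int)) (2*R+1) st)
/-- the built R = 5 patch: sites, seam rows (x, y, z, F_p), ΣF. -/
def build : St := scanI 10 (2*10+1) ⟨0, [], 0⟩

/-- integer Newton iteration for √ (fuelled, monotone). -/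
def isqrtIter (n : Nat) : Nat → Nat → Nat
  | 0, g => g
  | f+1, g => let g' := (g + n / g) / 2; if g' < g then isqrtIter n f g' else g

/-- upper bound (scale 2⁶⁰) of G∞ at conventional squared distance d2 > 0. -/
def gInf (d2 : Nat) : Nat :=
  let s := isqrtIter (d2 * S * S) 64 (S * 64)
  let inv := ceilDiv (S*S) s
  min G0S (ceilDiv (CS * inv) S)

/-- a seam row: integer fcc coordinates and the exterior-bond load F_p (scale 2⁶⁰). -/
abbrev Row := Int × Int × Int × Nat

/-- pair weight F_p · F_q · G∞(p,q) (scale 2¹⁸⁰). -/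
def pairVal (p q : Row) : Nat :=
  let dx := p.1 - q.1
  let dy := p.2.1 - q.2.1
  let dz := p.2.2.1 - q.2.2.1
  let d2 : Nat := (dx*dx + dy*dy + dz*dz).toNat
  let g := if d2 == 0 then G0S else gInf d2
  p.2.2.2 * q.2.2.2 * g
/-- accumulator step of the double sum (accumulator-additive BY DEFINITION: `pairStep acc p q = acc + pairVal p q` is `rfl`). -/
def pairStep (acc : Nat) (p q : Row) : Nat := acc + pairVal p q

/-- THE OBJECT: the plain double left fold ΣΣ over p, q in seam of F_p F_q G∞(p,q) (scale 2¹⁸⁰). -/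
def total (seam : List Row) : Nat :=
  seam.foldl (fun acc p => seam.foldl (fun acc' q => pairStep acc' p q) acc) 0


/-- indexed left fold (core-only). -/
def foldIdx {α β : Type} (f : Nat → β → α → β) : List α → Nat → β → β
  | [], _, acc => acc
  | a :: l, i, acc => foldIdx f l (i+1) (f i acc a)

/-- one outer step of the chunked sum: add row p's inner fold iff its index i lies in [lo, hi). -/
def chunkStep (seam : List Row) (lo hi : Nat) (i : Nat) (acc : Nat) (p : Row) : Nat :=
  if lo ≤ i then (if i < hi then seam.foldl (fun acc' q => pairStep acc' p q) acc else acc) else acc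

/-- partial double sum over seam rows with index in [lo, hi). -/
def totalChunk (seam : List Row) (lo hi : Nat) : Nat :=
  foldIdx (chunkStep seam lo hi) seam 0 0

/-! ### STRUCTURAL LEMMAS (generic in `seam`; induction only — no `decide`, kernel-light; core tactics, 0 imports) -/

/-- the inner fold is accumulator-additive. -/
theorem foldl_pairStep_acc (seam : List Row) (p : Row) (acc : Nat) :
    seam.foldl (fun acc' q => pairStep acc' p q) acc = acc + seam.foldl (fun acc' q => pairStep acc' p q) 0 := by
  induction seam generalizing acc with
  | nil => rfl
  | cons q l ih =>
    simp only [List.foldl]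
    rw [ih (pairStep acc p q), ih (pairStep 0 p q)]
    simp only [pairStep]
    omega

/-- the outer step is accumulator-additive. -/
theorem chunkStep_acc (seam : List Row) (lo hi i acc : Nat) (p : Row) :
    chunkStep seam lo hi i acc p = acc + chunkStep seam lo hi i 0 p := by
  unfold chunkStep
  split
  · split
    · exact foldl_pairStep_acc seam p acc
    · rfl
  · rfl

/-- the outer step splits at any mid point. -/
theorem chunkStep_split (seam : List Row) {lo mid hi : Nat} (hlm : lo ≤ mid) (hmh : mid ≤ hi) (i : Nat) (p : Row) :
    chunkStep seam lo hi i 0 p = chunkStep seam lo mid i 0 p + chunkStep seam mid hi i 0 p := by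
  unfold chunkStep
  split <;> (try split) <;> (try split) <;> (try split) <;> (try split) <;> (try split) <;> omega

/-- the indexed fold of the outer step is accumulator-additive. -/
theorem foldIdx_chunkStep_acc (seam : List Row) (lo hi : Nat) (l : List Row) (i acc : Nat) :
    foldIdx (chunkStep seam lo hi) l i acc = acc + foldIdx (chunkStep seam lo hi) l i 0 := by
  induction l generalizing i acc with
  | nil => rfl
  | cons a l ih =>
    simp only [foldIdx]
    rw [ih (i+1) (chunkStep seam lo hi i acc a), ih (i+1) (chunkStep seam lo hi i 0 a), chunkStep_acc seam lo hi i acc a]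
    omega

/-- the indexed fold splits at any mid point. -/
theorem foldIdx_chunkStep_split (seam : List Row) {lo mid hi : Nat} (hlm : lo ≤ mid) (hmh : mid ≤ hi) (l : List Row) (i : Nat) :
    foldIdx (chunkStep seam lo hi) l i 0 = foldIdx (chunkStep seam lo mid) l i 0 + foldIdx (chunkStep seam mid hi) l i 0 := by
  induction l generalizing i with
  | nil => rfl
  | cons a l ih =>
    simp only [foldIdx]
    rw [foldIdx_chunkStep_acc seam lo hi, foldIdx_chunkStep_acc seam lo mid, foldIdx_chunkStep_acc seam mid hi,
      ih (i+1), chunkStep_split seam hlm hmh i a]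
    omega

/-- with lo = 0 and hi beyond the last index, the chunked fold IS the plain double fold. -/
theorem foldIdx_chunkStep_full (seam : List Row) (hi : Nat) (l : List Row) (i acc : Nat) (h : i + l.length ≤ hi) :
    foldIdx (chunkStep seam 0 hi) l i acc = l.foldl (fun acc p => seam.foldl (fun acc' q => pairStep acc' p q) acc) acc := by
  induction l generalizing i acc with
  | nil => rfl
  | cons a l ih =>
    simp only [List.length_cons] at h
    simp only [foldIdx, List.foldl]
    have h1 : i < hi := by omega
    have hs : chunkStep seam 0 hi i acc a = seam.foldl (fun acc' q => pairStep acc' a q) acc := by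
      unfold chunkStep
      rw [if_pos (Nat.zero_le i), if_pos h1]
    rw [hs]
    exact ih (i+1) _ (by omega)

/-- ★ SPLIT LEMMA (r1709 (C)(i)): consecutive chunks add up. -/
theorem totalChunk_split (seam : List Row) {lo mid hi : Nat} (hlm : lo ≤ mid) (hmh : mid ≤ hi) :
    totalChunk seam lo mid + totalChunk seam mid hi = totalChunk seam lo hi := by
  unfold totalChunk
  exact (foldIdx_chunkStep_split seam hlm hmh seam 0).symm

/-- ★ FULL-RANGE LEMMA (r1709 (C)(i)): the object equals the single chunk [0, |seam|). -/
theorem total_eq_totalChunk (seam : List Row) : total seam = totalChunk seam 0 seam.length := by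
  unfold total totalChunk
  exact (foldIdx_chunkStep_full seam seam.length seam 0 0 (by omega)).symm

/-! NOTE (g52 bisection T52_A–D): never make the ELABORATOR unify against a term containing `build`/`total` under an arithmetic head
(`show …`, term-mode `exact` across `pilot` projections): Meta-level whnf then evaluates the whole patch scan (rc 124 at 150 s / 600 s);
use `rw` with syntactic equation lemmas, `unfold pilot; dsimp only`, and `decide +kernel` only on literal goals (file D: 0.6 s). -/

/-- pilot output record (nP, nSeam, ΣF, ⌈S_E/ε²·2⁶⁰⌉). -/
structure Out where
  nP : Nat
  nSeam : Nat
  sumF : Nat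
  sE : Nat

/-- the pilot: (patch sites, seam sites, ΣF at scale 2⁶⁰, ⌈S_E/ε²⌉ at scale 2⁶⁰ = ½·ΣΣ/2¹²⁰ rounded up). -/
def pilot : Out :=
  let st := build
  ⟨st.nP, st.seam.length, st.sumF, ceilDiv (total st.seam) (2 * S * S)⟩

end Summit.AtomisticToContinuum.Crystallization.Theorems.ChartedZeroExcessLayeredLatticeLiouville.G2SeamR5
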